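import Summits.Ventures.GridStability.Models.StructurePreservingDichotomy
import HarnessLib

/-!
# GridStability/Models/StructurePreservingSynchronization — the dichotomy of the Bergen–Hill model
# read in the frame rotating at the synchronous frequency: every motion of MODEL MV-3 either LOSES
# SYNCHRONISM BETWEEN BUSES or FREQUENCY-SYNCHRONISES at `ω₀ = Σ P⁰ᵢ / Σ Dᵢ` (all `n` buses, loads
# included) with vanishing power mismatches; cohesive motions synchronise

LADDER-GRIDFUSION G3 / G2 (structure-preserving lever), seat gridfusion-model-2 (g8);
`plan/MODEL-VALIDITY.md` row **MV-3**. Continues `StructurePreservingDichotomy.lean`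
(`tendsto_freeEnergy_atBot_or_quasistatic`: along every forward phase solution EITHER `U → −∞` with
`Σᵢ P⁰ᵢ δᵢ → +∞` OR the motion is quasi-static). Alternative (a) stated with the raw work
`Σ P⁰ᵢ δᵢ` depends on the frame; the printed model is read in the frame rotating at
`ω₀ = Σ P⁰ᵢ / Σ Dᵢ` [cite: Padiyar2013, §3.2 eqs (3.3)–(3.5)] (model-2's `p.shifted`,
`IsSolution.shift`), where the powers `P̄ᵢ = P⁰ᵢ − Dᵢ ω₀` satisfy `Σ P̄ᵢ = 0` (`sum_Pbar_eq_zero`),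
so the work equals `Σᵢ P̄ᵢ (δᵢ − δₖ)` for EVERY reference bus `k` (`sum_mul_eq_sum_mul_sub`): it is
a function of the angle DIFFERENCES, and (a) is loss of synchronism between the buses. This is the
structure-preserving analogue of lit-1's frame-correct dichotomy for isolated network-reduced models
(`LosslessSystem.tendsto_sum_abs_sub_atTop_or_quasistatic_syncFrame`, [cite: DorflerBullo2012, §2.1,
§4.1]); the quasi-static alternative here says that EVERY bus frequency — generator rotors AND
load-bus voltage angles — tends to `ω₀`.

## Contents (all PROVED; MODELLED column only — MODEL MV-3, [cite: BergenHill1981] as printed in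
[cite: Padiyar2013, §3.2 eq (3.2)])
* §1 `sum_mul_eq_sum_mul_sub`, `sum_mul_sub_le` (work vs angle spread when `Σ P = 0`).
* §2 `tendsto_work_sub_atTop_or_quasistatic` — the dichotomy for data with `Σ P⁰ᵢ = 0` with (a) as
  `Σᵢ P⁰ᵢ(δᵢ − δₖ) → +∞` for every `k`; `quasistatic_of_cohesive` — bounded angle differences
  (any bound) exclude (a): COHESIVE ⇒ QUASI-STATIC.
* §3 the printed second-order model (`p.IsSolution δ`, powers `P⁰`): `vel_toPhase_shift` (the
  shifted phase velocity of bus `i` IS `δ̇ᵢ − ω₀`), **`IsSolution.desync_or_syncFreq`** — every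
  solution EITHER has `Σᵢ P̄ᵢ(δᵢ(t) − δₖ(t)) → +∞` for every reference bus OR has `δ̇ᵢ(t) → ω₀` at
  EVERY bus and `P̄ᵢ − fᵢ(δ(t)) → 0` at every bus; **`IsSolution.syncFreq_of_cohesive`** — if all
  angle differences stay bounded, every bus frequency tends to `ω₀` and every mismatch vanishes.
* §4 `dichotomy_of_initialState` — from EVERY phase point (existence by
  `exists_phaseSolution_Icc`, uniqueness `phaseSolution_unique`): the class is «all initial states».
THREE COLUMNS: mathematics about MODEL MV-3 (lossless, |V| ≡ 1, frequency-dependent loads, classical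
machines); NOT CLAIMED: which alternative occurs from a given state, convergence of the angles,
anything about a grid. [cite: Chiang1995, §3 Thm 3.1, §6]
-/

noncomputable section

open Real Set Filter Topology Finset

namespace Summit.Ventures.GridStability.Models.StructurePreserving.Params

variable {n : ℕ}

/-! ### §1. Work and angle spread when the powers sum to zero -/

/-- With `Σᵢ Pᵢ = 0` the work `Σᵢ Pᵢ δᵢ` is a function of the angle DIFFERENCES:
`Σᵢ Pᵢ δᵢ = Σᵢ Pᵢ (δᵢ − δₖ)` for every reference bus `k`. [cite: Padiyar2013, §3.2 eqs (3.5)–(3.6)] -/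
theorem sum_mul_eq_sum_mul_sub {P : Fin n → ℝ} (hP : ∑ i, P i = 0) (δ : Fin n → ℝ) (k : Fin n) :
    ∑ i, P i * δ i = ∑ i, P i * (δ i - δ k) := by
  simp only [mul_sub, Finset.sum_sub_distrib, ← Finset.sum_mul, hP, zero_mul, sub_zero]

/-- The differenced work is controlled by the angle spread: if `|δᵢ − δⱼ| ≤ B` for all pairs then
`Σᵢ Pᵢ (δᵢ − δₖ) ≤ (Σᵢ |Pᵢ|)·B`. [cite: Padiyar2013, §3.2 eq (3.6)] -/
theorem sum_mul_sub_le (P δ : Fin n → ℝ) (k : Fin n) {B : ℝ} (hB : ∀ i j, |δ i - δ j| ≤ B) :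
    ∑ i, P i * (δ i - δ k) ≤ (∑ i, |P i|) * B := by
  rw [Finset.sum_mul]
  refine Finset.sum_le_sum fun i _ => (le_abs_self _).trans ?_
  rw [abs_mul]
  exact mul_le_mul_of_nonneg_left (hB i k) (abs_nonneg _)

/-! ### §2. The dichotomy for powers summing to zero: desynchronisation or quasi-static -/

/-- **Frame-correct dichotomy** (data with `Σᵢ P⁰ᵢ = 0` — the model in the `ω₀`-frame,
`p.shifted`): every forward phase solution EITHER (a) has `U → −∞` and, for EVERY reference bus `k`,
`Σᵢ P⁰ᵢ (δᵢ(t) − δₖ(t)) → +∞` — the `P⁰`-weighted angle spread diverges: LOSS OF SYNCHRONISM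
BETWEEN THE BUSES — OR (b) is quasi-static (energy converges, every bus velocity, every generator
speed and every power mismatch tends to `0`). [cite: Chiang1995, §3 Thm 3.1, §6; Padiyar2013, §3.2 eqs (3.2)–(3.6)] -/
theorem tendsto_work_sub_atTop_or_quasistatic {p : Params n} (hp : p.WellFormed)
    (hP : ∑ i, p.P0 i = 0) {X : ℝ → (Fin n → ℝ) × (Fin n → ℝ)}
    (hX : ∀ T : ℝ, ∀ t ∈ Icc 0 T, HasDerivWithinAt X (p.phaseField (X t)) (Icc 0 T) t) :
    (Tendsto (fun t => p.freeEnergy (X t)) atTop atBot ∧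
        ∀ k, Tendsto (fun t => ∑ i, p.P0 i * ((X t).1 i - (X t).1 k)) atTop atTop) ∨
      ((∃ e : ℝ, Tendsto (fun t => p.freeEnergy (X t)) atTop (𝓝 e)) ∧
        (∀ i, Tendsto (fun t => p.vel (X t) i) atTop (𝓝 0)) ∧
        (∀ i ∈ p.gen, Tendsto (fun t => (X t).2 i) atTop (𝓝 0)) ∧
        ∀ i, Tendsto (fun t => p.P0 i - p.pe (X t).1 i) atTop (𝓝 0)) := by
  rcases tendsto_freeEnergy_atBot_or_quasistatic hp hX with ⟨hU, hW⟩ | hb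
  · refine Or.inl ⟨hU, fun k => hW.congr' (Eventually.of_forall fun t => ?_)⟩
    exact sum_mul_eq_sum_mul_sub hP (X t).1 k
  · exact Or.inr hb

/-- **Cohesive ⇒ quasi-static** (data with `Σᵢ P⁰ᵢ = 0`): if along a forward phase solution all
angle differences stay bounded — `|δᵢ(t) − δⱼ(t)| ≤ B` for all `t ≥ 0`, ANY bound `B` — then the
motion is quasi-static: the free energy converges, every bus velocity and generator speed tends to
`0` and every power mismatch `P⁰ᵢ − fᵢ(δ(t)) → 0` (alternative (a) would make the bounded quantity
`Σ P⁰ᵢ(δᵢ − δₖ)` diverge). [cite: Chiang1995, §3 Thm 3.1, §6; Padiyar2013, §3.2 eqs (3.2)–(3.6)] -/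
theorem quasistatic_of_cohesive {p : Params n} (hp : p.WellFormed) (hP : ∑ i, p.P0 i = 0)
    {X : ℝ → (Fin n → ℝ) × (Fin n → ℝ)}
    (hX : ∀ T : ℝ, ∀ t ∈ Icc 0 T, HasDerivWithinAt X (p.phaseField (X t)) (Icc 0 T) t)
    {B : ℝ} (hB : ∀ t, 0 ≤ t → ∀ i j, |(X t).1 i - (X t).1 j| ≤ B) :
    (∃ e : ℝ, Tendsto (fun t => p.freeEnergy (X t)) atTop (𝓝 e)) ∧
      (∀ i, Tendsto (fun t => p.vel (X t) i) atTop (𝓝 0)) ∧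
      (∀ i ∈ p.gen, Tendsto (fun t => (X t).2 i) atTop (𝓝 0)) ∧
      ∀ i, Tendsto (fun t => p.P0 i - p.pe (X t).1 i) atTop (𝓝 0) := by
  rcases tendsto_freeEnergy_atBot_or_quasistatic hp hX with ⟨-, hW⟩ | hb
  · exfalso
    set M := (∑ i, |p.P0 i|) * B + 1 with hM
    obtain ⟨t, ht, ht0⟩ := ((tendsto_atTop.1 hW M).and (eventually_ge_atTop 0)).exists
    rcases isEmpty_or_nonempty (Fin n) with hn | ⟨⟨k⟩⟩
    · have h0 : ∑ i, p.P0 i * (X t).1 i = 0 :=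
        Finset.sum_eq_zero fun i _ => (IsEmpty.false i).elim
      have h1 : ∑ i, |p.P0 i| = 0 := Finset.sum_eq_zero fun i _ => (IsEmpty.false i).elim
      rw [h0] at ht
      rw [h1] at hM
      linarith
    · rw [sum_mul_eq_sum_mul_sub hP (X t).1 k] at ht
      have hle := sum_mul_sub_le p.P0 (X t).1 k (hB t ht0)
      linarith
  · exact hb

/-! ### §3. The printed second-order model: desynchronisation or frequency synchronisation -/

/-- The shifted data are well formed when the data are. [cite: Padiyar2013, §3.2 eqs (3.4)–(3.5)] -/
theorem WellFormed.shifted {p : Params n} (hp : p.WellFormed) : p.shifted.WellFormed :=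
  ⟨hp.M_pos, hp.M_eq_zero, hp.D_pos, hp.b_symm⟩

/-- The shifted powers sum to zero (well-formed data, `n ≠ 0`): `Σᵢ P̄ᵢ = 0`.
[cite: Padiyar2013, §3.2 eq (3.5)] -/
theorem sum_shifted_P0_eq_zero {p : Params n} (hp : p.WellFormed) (hn : n ≠ 0) :
    ∑ i, p.shifted.P0 i = 0 := by
  simpa using p.sum_Pbar_eq_zero (sum_D_pos hp hn).ne'

/-- **The shifted phase velocity of bus `i` is `δ̇ᵢ − ω₀`** — at EVERY bus (generator: the
frequency coordinate of the phase curve; load bus: the first-order load equation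
`Dᵢ δ̇ᵢ = P⁰ᵢ − fᵢ(δ)`): for a printed-form solution `δ` and `δ'ᵢ(t) = δᵢ(t) − ω₀ t`,
`p.shifted.vel (p.shifted.toPhase δ' t) i = δ̇ᵢ(t) − ω₀`. [cite: Padiyar2013, §3.2 eqs (3.2)–(3.5), (3.10)] -/
theorem vel_toPhase_shift {p : Params n} (hp : p.WellFormed) {δ : ℝ → Fin n → ℝ}
    (hδ : p.IsSolution δ) (t : ℝ) (i : Fin n) :
    p.shifted.vel (p.shifted.toPhase (fun s j => δ s j - p.syncFreq * s) t) i
      = deriv (fun u => δ u i) t - p.syncFreq := by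
  have hs := hδ.shift
  have h1 := (hs.hasDerivAt_toPhase hp.shifted t).hasFDerivAt.fst.hasDerivAt
  have h2 : HasDerivAt (fun s => fun j => δ s j - p.syncFreq * s)
      (p.shifted.vel (p.shifted.toPhase (fun s j => δ s j - p.syncFreq * s) t)) t := by
    simpa using h1
  have h3 := ((hasDerivAt_pi.1 h2) i).deriv
  have h4 : HasDerivAt (fun s => δ s i - p.syncFreq * s)
      (deriv (fun u => δ u i) t - p.syncFreq) t := by
    have ha := ((hδ.differentiable i) t).hasDerivAt
    have hb : HasDerivAt (fun s : ℝ => p.syncFreq * s) p.syncFreq t := by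
      simpa using (hasDerivAt_id t).const_mul p.syncFreq
    exact ha.sub hb
  rw [← h3, h4.deriv]

/-- **GLOBAL BEHAVIOUR OF THE BERGEN–HILL MODEL AS PRINTED: DESYNCHRONISATION OR FREQUENCY
SYNCHRONISATION AT `ω₀`.** Let `p` be well-formed data of MODEL MV-3 on `n ≠ 0` buses (`Mᵢ > 0` on
the generator nodes, `Mᵢ = 0` at the load buses, `Dᵢ > 0`, `b` symmetric), any coupling graph, any
powers, and let `δ` be ANY solution of the printed second-order model
`Mᵢ δ̈ᵢ + Dᵢ δ̇ᵢ + fᵢ(δ) = P⁰ᵢ` (`p.IsSolution δ`). With `ω₀ = Σ P⁰ᵢ / Σ Dᵢ`, `P̄ᵢ = P⁰ᵢ − Dᵢ ω₀`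
and `U` the free energy of the shifted phase curve, EXACTLY ONE of: (a) `U → −∞` and for EVERY
reference bus `k` the weighted angle spread `Σᵢ P̄ᵢ (δᵢ(t) − δₖ(t)) → +∞` (the buses lose
synchronism with each other); (b) `U` converges, EVERY bus frequency `δ̇ᵢ(t) → ω₀` (generator rotors
AND load-bus angles) and EVERY power mismatch `P̄ᵢ − fᵢ(δ(t)) → 0`. No third behaviour (no bounded
sustained oscillation) exists in MODEL MV-3. THREE COLUMNS: mathematics about the typed model;
NOT CLAIMED: which alternative occurs, convergence of the angles, anything about a grid.
[cite: Chiang1995, §3 Thm 3.1 and §6 (network-preserving models, Bergen–Hill [35]); Padiyar2013, §3.2 eqs (3.2)–(3.5), (3.10)–(3.11), Remark 2; Leonov2001, Ch. 4 §4.2 Thm 4.1] -/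
theorem IsSolution.desync_or_syncFreq {p : Params n} (hp : p.WellFormed) (hn : n ≠ 0)
    {δ : ℝ → Fin n → ℝ} (hδ : p.IsSolution δ) :
    (Tendsto (fun t => p.shifted.freeEnergy
          (p.shifted.toPhase (fun s j => δ s j - p.syncFreq * s) t)) atTop atBot ∧
        ∀ k, Tendsto (fun t => ∑ i, p.Pbar i * (δ t i - δ t k)) atTop atTop) ∨
      ((∃ e : ℝ, Tendsto (fun t => p.shifted.freeEnergy
          (p.shifted.toPhase (fun s j => δ s j - p.syncFreq * s) t)) atTop (𝓝 e)) ∧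
        (∀ i, Tendsto (fun t => deriv (fun u => δ u i) t) atTop (𝓝 p.syncFreq)) ∧
        ∀ i, Tendsto (fun t => p.Pbar i - p.pe (δ t) i) atTop (𝓝 0)) := by
  have hp' := hp.shifted
  have hs := hδ.shift
  set X := p.shifted.toPhase (fun s j => δ s j - p.syncFreq * s) with hXdef
  have hX : ∀ T : ℝ, ∀ t ∈ Icc 0 T, HasDerivWithinAt X (p.shifted.phaseField (X t)) (Icc 0 T) t :=
    fun T t ht => hs.toPhase_solution hp' T t ht
  have hpe : ∀ t i, p.pe (fun j => δ t j - p.syncFreq * t) i = p.pe (δ t) i := fun t i => by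
    have := p.pe_add_const (δ t) (-(p.syncFreq * t))
    simpa [sub_eq_add_neg] using congrFun this i
  rcases tendsto_work_sub_atTop_or_quasistatic hp' (sum_shifted_P0_eq_zero hp hn) hX with
    ⟨hU, hW⟩ | ⟨he, hv, -, hmis⟩
  · refine Or.inl ⟨hU, fun k => (hW k).congr' (Eventually.of_forall fun t => ?_)⟩
    simp only [hXdef, toPhase_fst, shifted_P0]
    exact Finset.sum_congr rfl fun i _ => by ring
  · refine Or.inr ⟨he, fun i => ?_, fun i => ?_⟩
    · have h := (hv i).add_const p.syncFreq
      rw [zero_add] at h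
      refine h.congr' (Eventually.of_forall fun t => ?_)
      rw [hXdef, vel_toPhase_shift hp hδ t i]
      ring
    · refine (hmis i).congr' (Eventually.of_forall fun t => ?_)
      simp only [hXdef, toPhase_fst, shifted_P0, shifted_pe, hpe]

/-- **Cohesive ⇒ frequency synchronisation of ALL buses (printed model).** If along a solution of
the printed model all bus-angle differences stay bounded — `|δᵢ(t) − δⱼ(t)| ≤ B` for `t ≥ 0`, ANY
bound — then every bus frequency `δ̇ᵢ(t) → ω₀ = Σ P⁰ᵢ / Σ Dᵢ` (generators and loads) and every
mismatch `P̄ᵢ − fᵢ(δ(t)) → 0`. No window, connectivity or equilibrium hypothesis. MODEL MV-3;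
nothing here says a grid synchronises. [cite: Chiang1995, §3 Thm 3.1, §6; Padiyar2013, §3.2 eqs (3.2)–(3.5), Remark 2] -/
theorem IsSolution.syncFreq_of_cohesive {p : Params n} (hp : p.WellFormed) (hn : n ≠ 0)
    {δ : ℝ → Fin n → ℝ} (hδ : p.IsSolution δ)
    {B : ℝ} (hB : ∀ t, 0 ≤ t → ∀ i j, |δ t i - δ t j| ≤ B) :
    (∀ i, Tendsto (fun t => deriv (fun u => δ u i) t) atTop (𝓝 p.syncFreq)) ∧
      ∀ i, Tendsto (fun t => p.Pbar i - p.pe (δ t) i) atTop (𝓝 0) := by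
  have hp' := hp.shifted
  have hs := hδ.shift
  set X := p.shifted.toPhase (fun s j => δ s j - p.syncFreq * s) with hXdef
  have hX : ∀ T : ℝ, ∀ t ∈ Icc 0 T, HasDerivWithinAt X (p.shifted.phaseField (X t)) (Icc 0 T) t :=
    fun T t ht => hs.toPhase_solution hp' T t ht
  have hpe : ∀ t i, p.pe (fun j => δ t j - p.syncFreq * t) i = p.pe (δ t) i := fun t i => by
    have := p.pe_add_const (δ t) (-(p.syncFreq * t))
    simpa [sub_eq_add_neg] using congrFun this i
  have hB' : ∀ t, 0 ≤ t → ∀ i j, |(X t).1 i - (X t).1 j| ≤ B := fun t ht i j => by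
    simp only [hXdef, toPhase_fst]
    have : δ t i - p.syncFreq * t - (δ t j - p.syncFreq * t) = δ t i - δ t j := by ring
    rw [this]
    exact hB t ht i j
  obtain ⟨-, hv, -, hmis⟩ := quasistatic_of_cohesive hp' (sum_shifted_P0_eq_zero hp hn) hX hB'
  refine ⟨fun i => ?_, fun i => ?_⟩
  · have h := (hv i).add_const p.syncFreq
    rw [zero_add] at h
    refine h.congr' (Eventually.of_forall fun t => ?_)
    rw [hXdef, vel_toPhase_shift hp hδ t i]
    ring
  · refine (hmis i).congr' (Eventually.of_forall fun t => ?_)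
    simp only [hXdef, toPhase_fst, shifted_P0, shifted_pe, hpe]

/-! ### §4. From every initial state -/

/-- **The dichotomy from EVERY phase point** (the class is «all initial states», literally): for
well-formed data and every `y` there IS a forward solution with `X 0 = y` (global Lipschitz field,
`exists_phaseSolution_Icc`; it is unique, `phaseSolution_unique`) and it has one of the two
behaviours of `tendsto_freeEnergy_atBot_or_quasistatic`. [cite: Chiang1995, §3 Thm 3.1, §6; Hartman2002, Ch. III Thm. 5.1] -/
theorem dichotomy_of_initialState {p : Params n} (hp : p.WellFormed)
    (y : (Fin n → ℝ) × (Fin n → ℝ)) :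
    ∃ X : ℝ → (Fin n → ℝ) × (Fin n → ℝ), X 0 = y ∧
      (∀ T : ℝ, ∀ t ∈ Icc 0 T, HasDerivWithinAt X (p.phaseField (X t)) (Icc 0 T) t) ∧
      ((Tendsto (fun t => p.freeEnergy (X t)) atTop atBot ∧
          Tendsto (fun t => ∑ i, p.P0 i * (X t).1 i) atTop atTop) ∨
        ((∃ e : ℝ, Tendsto (fun t => p.freeEnergy (X t)) atTop (𝓝 e)) ∧
          (∀ i, Tendsto (fun t => p.vel (X t) i) atTop (𝓝 0)) ∧
          (∀ i ∈ p.gen, Tendsto (fun t => (X t).2 i) atTop (𝓝 0)) ∧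
          ∀ i, Tendsto (fun t => p.P0 i - p.pe (X t).1 i) atTop (𝓝 0))) := by
  obtain ⟨X, h0, hX⟩ := p.exists_phaseSolution_Icc y
  exact ⟨X, h0, hX, tendsto_freeEnergy_atBot_or_quasistatic hp hX⟩

end Summit.Ventures.GridStability.Models.StructurePreserving.Params

end
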